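import Summits.BirchSwinnertonDyer.BirchSwinnertonDyer.Theorems.PrintCf2RamifiedOffTYZGenusCharacter
import Summits.BirchSwinnertonDyer.BirchSwinnertonDyer.Theorems.PrintCf2RamifiedOffTYZLowerHalfVisibleSeven
import HarnessLib

/-!
# Route `PrintCf2`, crux stmt-BirchSwinnertonDyer-20509 `RamifiedOffTYZOfFacts` — GENERATOR DEPTH, part 1: Galois preliminaries on
# `ℍ′_n ⊇ K_n` and the DESCENT of `χ_n`-equivariant points of `A(ℍ′_n)` to `A_n(ℚ)`
# (cell `bsd-print-cf2`, LEAD of 20509 g18, line `offtyz-v7`, lineage cycle 19; fact-free, Theses-free, no `def`)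

HONEST FRAMING (cell `bsd-print-cf2`, run/shared/lean/pub/bsd-print-cf2/; route `PrintCf2`; crux 20509 =
`𝔅_ram → WAllCornerFTwoRamifiedOffTYZProved`, DECIDING, OPEN AS A CLASS; C⁺ = `stub_offTYZ_levelTwoScriptLExact` = item
stmt-BirchSwinnertonDyer-23431, OPEN).  Pure algebra on the tree's objects: TYZ's curve `A = curveA : Y² = X³ + 4X` over the displayed field
`D.H = ℍ′_n` of `D : GenusPointData n` (Galois over `ℚ`, containing `i` and `√−n`), the twist transfer `Θ_A : A_n(ℚ) → A(K_n)⁻` of the W2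
kernel and the embedding `ι : K_n → ℍ′_n`.  No printed statement of TYZ §3 is used; nothing is asserted; no named fact is introduced.
This is the first of three files of lineage cycle 19 (`…GeneratorDescent` → `…GeneratorDepth` → `…GeneratorDepthRhoOne`) proving the LEAD
g17 census law (D1′) «the `A_n`-generator `α_n` has `2`-adic depth `≤ 1` in `A(ℍ′_n)/tors`» on the BLOCK-FREE family (`n ≡ 7 (mod 8)`, every
prime factor `≡ ±1 (mod 8)`, where `ℍ′_n = L_n(i)` is multiquadratic) and its consequences for C⁺.

* §0 `algHom_comp_embK_eq_comp_conj` (`g(√−n) = −√−n ⟹ g ∘ ι = ι ∘ conj`), `galPt_map_ΘA_of_fix` / `galPt_map_ΘA_of_flip` (an automorphism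
  fixes resp. NEGATES `ι Θ_A(P)` according to its sign on `√−n`: `Gal(ℍ′_n/ℚ)` acts on `ι Θ_A(A_n(ℚ))` through the character `χ_n` of `K_n`),
  `exists_algEquiv_im_eq_sqrtNeg_eq_neg` (square-free `n > 1`: some automorphism fixes `i` and negates `√−n` — else `√−n` or `i√−n` would be
  rational).
* §1 `exists_map_ΘA_eq_of_twisted` — **DESCENT**: a point `y ∈ A(ℍ′_n)` fixed by every automorphism fixing `√−n` and negated by every
  automorphism negating `√−n` is `ι Θ_A(P)` for some `P ∈ A_n(ℚ)` (its abscissa and `Y/√−n` are `Gal(ℍ′_n/ℚ)`-fixed, hence rational —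
  `IsGalois.mem_range_algebraMap_iff_fixed` — so `y ∈ ι A(K_n)⁻ = ι Θ_A(A_n(ℚ))`, `W2.exists_ΘA_eq`).

Beyond-print theorem: NO (Galois bookkeeping).  BSD is not proved by any of this; no class is closed by this file.

References: [cite: TianYuanZhang2017, §1 (arXiv:1411.4728 chunk p0002 L101–L110: `ρ(n)`, `φ_n`), §3.1 (p0011 L27–L36: `A(K_n)⁻`, `α_n`;
p0011 L58–L66: `ℍ′_n := L_n(i)·∏ H′_{d₀}`), Prop. 3.2 (3) (p0010 L112), Thm. 3.5 (p0011 L94–L100), Lemma 3.16 (p0017 L98–L113),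
Lemma 3.18 (p0017 L152–L153)]; [cite: SilvermanAEC2009, Prop. X.4.9, X.5 Cor. 5.4]; [cite: Darmon2004, Thm. 3.22] (GZK, binder `hGZK`);
[cite: Lang2002, VI §1 Thm. 1.2, Cor. 1.4]; tree: `…LevelTwoRhoValve` (g3), `…LevelTwoHalves` / `…LevelTwoGenusQuotient` (g11),
`…LevelTwoDepth` (g3), `…VisibleGenerator` / `…LowerHalfVisibleSeven` / `TianYuanZhang2017/CMPointCompositumDisplays` (g16),
`TianYuanZhang2017/GenusDescent{Defs,Twist,EnSide}` (W2 kernel), LEAD memo `Cruxes/RamifiedOffTYZOfFacts/Lines/offtyz_v7_GeneratorDepth.md`.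
-/

noncomputable section

open scoped Classical

open WeierstrassCurve WeierstrassCurve.Affine WeierstrassCurve.Affine.Point
  Literature.NumberTheory.EllipticCurves Literature.NumberTheory.EllipticCurves.Rank1Residual
  Summit.BirchSwinnertonDyer.Rank1Residual
  Literature.NumberTheory.EllipticCurves.TianYuanZhang2017
  Literature.NumberTheory.EllipticCurves.TianYuanZhang2017.W2
  Summit.BirchSwinnertonDyer.PrintCf2.GaloisMotion
  Summit.BirchSwinnertonDyer.Rank1Residual.P2.ThetaDescent
  Summit.BirchSwinnertonDyer.PrintCf2.LowerHalfVisible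

set_option autoImplicit false

namespace Summit.BirchSwinnertonDyer.PrintCf2.GeneratorDepth

variable {n : ℕ}

/-! ## §0 Galois preliminaries on `ℍ′_n ⊇ K_n = ℚ(√−n)` -/

/-- A square-free natural number `> 1` is not the square of a rational number. [folklore] -/
private theorem not_sq_eq_natCast_of_squarefree (hsq : Squarefree n) (hn1 : 1 < n) (q : ℚ) : q ^ 2 ≠ (n : ℚ) := by
  intro h
  have hsqQ : IsSquare (n : ℚ) := ⟨q, by rw [← h, sq]⟩
  obtain ⟨m, hm⟩ := Rat.isSquare_natCast_iff.1 hsqQ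
  have hmu : IsUnit m := hsq m ⟨1, by rw [mul_one]; exact hm⟩
  rw [Nat.isUnit_iff] at hmu
  subst hmu
  omega

/-- `g(√−n) = ±√−n` for every automorphism `g` of `ℍ′_n`. [cite: TianYuanZhang2017, §3.1 (p0011 L60–L64)] -/
private theorem apply_sqrtNeg_eq_or' (D : GenusPointData n) (hn : n ∈ n.divisors) (g : D.H ≃ₐ[ℚ] D.H) :
    g (D.sqrtNeg n) = D.sqrtNeg n ∨ g (D.sqrtNeg n) = -D.sqrtNeg n := by
  have h : (g (D.sqrtNeg n)) ^ 2 = (D.sqrtNeg n) ^ 2 := by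
    rw [← map_pow, D.sqrtNeg_sq n hn, map_neg, map_natCast]
  exact sq_eq_sq_iff_eq_or_eq_neg.mp h

/-- **If `g(√−n) = −√−n` then `g ∘ ι = ι ∘ conj`** for the embedding `ι : K_n → ℍ′_n` and the conjugation of `K_n`.
[cite: TianYuanZhang2017, §3.1 (p0011 L27–L36, L60–L64)] -/
theorem algHom_comp_embK_eq_comp_conj (D : GenusPointData n) (hn : n ∈ n.divisors) (g : D.H ≃ₐ[ℚ] D.H)
    (hgK : g (D.sqrtNeg n) = -D.sqrtNeg n) :
    (g : D.H →ₐ[ℚ] D.H).comp (D.embK n hn) = (D.embK n hn).comp (genusFieldConj n) := by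
  apply AdjoinRoot.algHom_ext
  have h1 : (D.embK n hn) (AdjoinRoot.root (genusFieldPoly n)) = D.sqrtNeg n := AdjoinRoot.liftAlgHom_root _ _ _ _
  have h2 : genusFieldConj n (AdjoinRoot.root (genusFieldPoly n)) = -AdjoinRoot.root (genusFieldPoly n) := conj_θn
  show g ((D.embK n hn) (AdjoinRoot.root (genusFieldPoly n))) =
    (D.embK n hn) (genusFieldConj n (AdjoinRoot.root (genusFieldPoly n)))
  rw [h1, hgK, h2, map_neg, h1]

/-- `g` FIXES the image `ι Θ_A(P)` of a point of `A_n(ℚ)` when `g(√−n) = √−n`. [cite: TianYuanZhang2017, §3.1 (p0011 L27–L36)] -/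
theorem galPt_map_ΘA_of_fix (hsq : Squarefree n) (D : GenusPointData n) (g : D.H ≃ₐ[ℚ] D.H)
    (hgK : g (D.sqrtNeg n) = D.sqrtNeg n) (P : (Atwo n).toAffine.Point) :
    D.galPt g (Point.map (W' := curveA) (D.embK n (Nat.mem_divisors_self n hsq.ne_zero)) (ΘA hsq.ne_zero P)) =
      Point.map (W' := curveA) (D.embK n (Nat.mem_divisors_self n hsq.ne_zero)) (ΘA hsq.ne_zero P) := by
  change Point.map (W' := curveA) (g : D.H →ₐ[ℚ] D.H) _ = _
  rw [Point.map_map, algHom_comp_embK_eq D _ g hgK]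

/-- `g` NEGATES the image `ι Θ_A(P)` of a point of `A_n(ℚ)` when `g(√−n) = −√−n` (`Θ_A(P) ∈ A(K_n)⁻`).
[cite: TianYuanZhang2017, §3.1 (p0011 L27–L36: A(K_n)⁻)] -/
theorem galPt_map_ΘA_of_flip (hsq : Squarefree n) (D : GenusPointData n) (g : D.H ≃ₐ[ℚ] D.H)
    (hgK : g (D.sqrtNeg n) = -D.sqrtNeg n) (P : (Atwo n).toAffine.Point) :
    D.galPt g (Point.map (W' := curveA) (D.embK n (Nat.mem_divisors_self n hsq.ne_zero)) (ΘA hsq.ne_zero P)) =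
      -Point.map (W' := curveA) (D.embK n (Nat.mem_divisors_self n hsq.ne_zero)) (ΘA hsq.ne_zero P) := by
  change Point.map (W' := curveA) (g : D.H →ₐ[ℚ] D.H) _ = _
  rw [Point.map_map, algHom_comp_embK_eq_comp_conj D _ g hgK, ← Point.map_map, map_conj_ΘA hsq.ne_zero P, map_neg]

/-- **There is an automorphism of `ℍ′_n` fixing `i` and negating `√−n`** (square-free `n > 1`; `ℍ′_n/ℚ` Galois with `i, √−n ∈ ℍ′_n`):
otherwise `√−n` or `i√−n` would be fixed by every automorphism, hence rational, and `−n` or `n` a rational square.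
[cite: TianYuanZhang2017, §3.1 (p0011 L60–L64)] [cite: Lang2002, VI §1 Thm. 1.2] -/
theorem exists_algEquiv_im_eq_sqrtNeg_eq_neg (D : GenusPointData n) (hsq : Squarefree n) (hn1 : 1 < n) :
    ∃ g : D.H ≃ₐ[ℚ] D.H, g D.im = D.im ∧ g (D.sqrtNeg n) = -D.sqrtNeg n := by
  have hn : n ∈ n.divisors := Nat.mem_divisors_self n hsq.ne_zero
  by_contra hne
  push Not at hne
  have hfixK : ∀ g : D.H ≃ₐ[ℚ] D.H, g D.im = D.im → g (D.sqrtNeg n) = D.sqrtNeg n := fun g hgi =>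
    (apply_sqrtNeg_eq_or' D hn g).resolve_right (hne g hgi)
  have hinj : Function.Injective (algebraMap ℚ D.H) := (algebraMap ℚ D.H).injective
  have hnpos : (0 : ℚ) < n := by exact_mod_cast (show 0 < n by omega)
  by_cases hall : ∀ g : D.H ≃ₐ[ℚ] D.H, g (D.sqrtNeg n) = D.sqrtNeg n
  · -- `√−n` is rational
    obtain ⟨q, hq⟩ := (IsGalois.mem_range_algebraMap_iff_fixed (D.sqrtNeg n)).mpr hall
    have hq2 : q ^ 2 = -(n : ℚ) := hinj (by rw [map_pow, hq, D.sqrtNeg_sq n hn, map_neg, map_natCast])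
    nlinarith [sq_nonneg q]
  · -- some `g₁` negates `√−n`; it must flip `i`, and then `i√−n` is fixed by everything
    push Not at hall
    obtain ⟨g₁, hg₁⟩ := hall
    have hg₁K : g₁ (D.sqrtNeg n) = -D.sqrtNeg n := (apply_sqrtNeg_eq_or' D hn g₁).resolve_left hg₁
    have hg₁i : g₁ D.im = -D.im := (apply_im_eq_or D g₁).resolve_left fun h => hg₁ (hfixK g₁ h)
    have hinv_i : g₁⁻¹ D.im = -D.im := by
      have e : g₁⁻¹ (g₁ D.im) = D.im := by rw [← AlgEquiv.mul_apply, inv_mul_cancel, AlgEquiv.one_apply]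
      rw [hg₁i, map_neg] at e
      linear_combination -e
    have hprod : ∀ g : D.H ≃ₐ[ℚ] D.H, g (D.im * D.sqrtNeg n) = D.im * D.sqrtNeg n := by
      intro g
      rcases apply_im_eq_or D g with hgi | hgi
      · rw [map_mul, hgi, hfixK g hgi]
      · have hhi : (g₁⁻¹ * g) D.im = D.im := by rw [AlgEquiv.mul_apply, hgi, map_neg, hinv_i, neg_neg]
        have hhK : (g₁⁻¹ * g) (D.sqrtNeg n) = D.sqrtNeg n := hfixK _ hhi
        have hgK : g (D.sqrtNeg n) = -D.sqrtNeg n := by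
          have e : g = g₁ * (g₁⁻¹ * g) := by group
          rw [e, AlgEquiv.mul_apply, hhK, hg₁K]
        rw [map_mul, hgi, hgK]; ring
    obtain ⟨q, hq⟩ := (IsGalois.mem_range_algebraMap_iff_fixed (D.im * D.sqrtNeg n)).mpr hprod
    have hq2 : q ^ 2 = (n : ℚ) := hinj (by
      rw [map_pow, hq, mul_pow, D.im_sq, D.sqrtNeg_sq n hn, map_natCast]; ring)
    exact not_sq_eq_natCast_of_squarefree hsq hn1 q hq2

/-! ## §1 Descent: a point on which `Gal(ℍ′_n/ℚ)` acts through the character of `K_n` comes from `A_n(ℚ)` -/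

/-- **DESCENT TO `A_n(ℚ)`.**  A point `y ∈ A(ℍ′_n)` FIXED by every automorphism fixing `√−n` and NEGATED by every automorphism negating
`√−n` is `ι Θ_A(P)` for a rational point `P ∈ A_n(ℚ)` (`A_n = Y² = X³ + 4n²X`): its abscissa and `Y/√−n` are fixed by all of
`Gal(ℍ′_n/ℚ)`, hence rational (`ℍ′_n/ℚ` Galois), so `y ∈ A(K_n)⁻ = Θ_A(A_n(ℚ))`.
[cite: TianYuanZhang2017, §3.1 (p0011 L27–L36: A(K_n)⁻, α_n)] [cite: SilvermanAEC2009, X.5 Cor. 5.4] [cite: Lang2002, VI §1 Thm. 1.2] -/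
theorem exists_map_ΘA_eq_of_twisted (hsq : Squarefree n) (D : GenusPointData n) (y : APoint D.H)
    (hfix : ∀ g : D.H ≃ₐ[ℚ] D.H, g (D.sqrtNeg n) = D.sqrtNeg n → D.galPt g y = y)
    (hflip : ∀ g : D.H ≃ₐ[ℚ] D.H, g (D.sqrtNeg n) = -D.sqrtNeg n → D.galPt g y = -y) :
    ∃ P : (Atwo n).toAffine.Point,
      Point.map (W' := curveA) (D.embK n (Nat.mem_divisors_self n hsq.ne_zero)) (ΘA hsq.ne_zero P) = y := by
  have hn0 : n ≠ 0 := hsq.ne_zero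
  have hn : n ∈ n.divisors := Nat.mem_divisors_self n hn0
  rcases y with _ | ⟨x, w, h⟩
  · exact ⟨0, by rw [_root_.map_zero, _root_.map_zero, Point.zero_def]⟩
  · obtain ⟨h1, -, h3, -, -⟩ := curveA_baseChange_a (H := D.H)
    have hnegY : (curveA.baseChange D.H).toAffine.negY x w = -w := by rw [negY, h1, h3]; ring
    have hs0 : D.sqrtNeg n ≠ 0 := fun h0 => by
      have := D.sqrtNeg_sq n hn
      rw [h0, zero_pow two_ne_zero, zero_eq_neg, Nat.cast_eq_zero] at this
      exact hn0 this
    -- `x` and `w/√−n` are fixed by every automorphism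
    have hxw : ∀ g : D.H ≃ₐ[ℚ] D.H, g x = x ∧ g (w / D.sqrtNeg n) = w / D.sqrtNeg n := by
      intro g
      rcases apply_sqrtNeg_eq_or' D hn g with hg | hg
      · have e := hfix g hg
        rw [GenusPointData.galPt, Point.map_some] at e
        obtain ⟨ex, ew⟩ := Point.some.inj e
        have ex' : g x = x := ex
        have ew' : g w = w := ew
        exact ⟨ex', by rw [map_div₀, ew', hg]⟩
      · have e := hflip g hg
        rw [GenusPointData.galPt, Point.map_some, Point.neg_some] at e
        obtain ⟨ex, ew⟩ := Point.some.inj e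
        rw [hnegY] at ew
        have ex' : g x = x := ex
        have ew' : g w = -w := ew
        exact ⟨ex', by rw [map_div₀, ew', hg, neg_div_neg_eq]⟩
    obtain ⟨qx, hqx⟩ := (IsGalois.mem_range_algebraMap_iff_fixed x).mpr fun g => (hxw g).1
    obtain ⟨qw, hqw⟩ := (IsGalois.mem_range_algebraMap_iff_fixed (w / D.sqrtNeg n)).mpr fun g => (hxw g).2
    have hw : w = algebraMap ℚ D.H qw * D.sqrtNeg n := by rw [hqw, div_mul_cancel₀ w hs0]
    -- the `K_n`-point `(qx, qw·θ)` of `A`, in the minus part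
    have hθ : D.embK n hn (θn n) = D.sqrtNeg n := AdjoinRoot.liftAlgHom_root _ _ _ _
    have hιX : D.embK n hn (algebraMap ℚ (GenusField n) qx) = x := by rw [AlgHom.commutes, hqx]
    have hιY : D.embK n hn (algebraMap ℚ (GenusField n) qw * θn n) = w := by rw [map_mul, AlgHom.commutes, hθ, hw]
    have heqH : w ^ 2 = x ^ 3 + 4 * x := (curveA_nonsingular_iff x w).mp h
    have heqK : (algebraMap ℚ (GenusField n) qw * θn n) ^ 2 =
        (algebraMap ℚ (GenusField n) qx) ^ 3 + 4 * algebraMap ℚ (GenusField n) qx := by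
      apply (D.embK n hn).toRingHom.injective
      change D.embK n hn _ = D.embK n hn _
      rw [map_pow, map_add, map_pow, hιY, map_mul (D.embK n hn) (4 : GenusField n), map_ofNat, hιX, heqH]
    have hP₁ : (curveA.baseChange (GenusField n)).toAffine.Nonsingular (algebraMap ℚ (GenusField n) qx)
        (algebraMap ℚ (GenusField n) qw * θn n) := (curveA_nonsingular_iff _ _).mpr heqK
    have hminus : (Point.some _ _ hP₁ : APoint (GenusField n)) ∈ minusPart n := by
      obtain ⟨k1, -, k3, -, -⟩ := curveA_baseChange_a (H := GenusField n)
      change Point.map (W' := curveA) (genusFieldConj n) (Point.some _ _ hP₁) = -Point.some _ _ hP₁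
      rw [Point.map_some, Point.neg_some]
      simp only [Point.some.injEq]
      refine ⟨AlgHom.commutes _ _, ?_⟩
      rw [negY, k1, k3, map_mul, AlgHom.commutes, conj_θn]; ring
    obtain ⟨P, hP⟩ := exists_ΘA_eq hn0 _ hminus
    refine ⟨P, ?_⟩
    rw [hP, Point.map_some]
    simp only [Point.some.injEq]
    exact ⟨hιX, hιY⟩


end Summit.BirchSwinnertonDyer.PrintCf2.GeneratorDepth

end
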